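import Summits.QuantumFields.Balaban3D.Proofs.Primitives

/-!
# Bałaban CMP 102 (1985), d = 3 lane — `Proofs.Family`: the per-step smallness premises ON THE EXHIBITED FAMILY `S.ε₀ = ε₀(S.g)`
# (R-EPS0′: `g_k ≤ γ₂₈, γ₄₆, γ_OO, γ₇₁` for `k ≤ K`, the (28) smallness) and the provisos NOT IN PRINT of the large-field row
# B25 DISCHARGED by the definition of `b₀`, `p₀` (ruling R-E2′)

Source: T. Bałaban, *Ultraviolet stability of three-dimensional lattice pure gauge field theories*, Commun. Math. Phys. **102** (1985)
255–275 [Balaban1985UV3] ([B10]; PDF page = journal page − 254): (7) p. 257, p. 256 L15–18, (28) p. 263, (45) p. 267, p. 272,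
(71) p. 273.  Lane `pub-balaban3d`, seat p3 (R-EPS0′, R-E2′; LEAF-LEDGER E2, K5/K7 of the lead's INPUTS-EXPECTED list).
`ε₀(g) = (min γ₀ 1)²/g²` with the group's `γ₀ = min(1, γ₂₈, γ₄₆, γ_OO, γ₇₁)` (`Primitives.AlphaConsts.gamma0`) makes every running
coupling `g_k ≤ γ₀` (`ScalesArithmetic.gk_le_gamma0_of_eps0Of`), hence below each seat's threshold; and with `b₀ := √(4·max(N,1)·
max(56, 8·A·K_c³/(½ log L)))`, `p₀ := 2r₀ + 1` the three provisos of LQB GAPs G-B10-02/G-B10-10 (E2-1 `3r₀ + 2 ≤ 2p₀`, E2-2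
`8·A·K_c³/(½ log L) ≤ b₀²/(4N)`, E2-3 `56 ≤ b₀²/(4N)`) are THEOREMS for every group with `N ≥ 1` (`GroupModel.N_pos`), stated
below in the vocabulary of the lane's carrier record exactly as seat p2's `LargeFieldStd.lf_stdTowerInput` consumes them.
Elementary real arithmetic; nothing of the paper is asserted.  No `sorry`.
-/

noncomputable section

namespace Summit.QuantumFields.Balaban3D.Proofs.Family

open Literature.MathematicalPhysics.QuantumFieldTheory.Balaban1983to89
open Literature.MathematicalPhysics.QuantumFieldTheory.Balaban1983to89.B10
open Literature.MathematicalPhysics.QuantumFieldTheory.Balaban1985CMP102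
open Literature.MathematicalPhysics.QuantumFieldTheory.Balaban1985CMP102.Setting
open Summit.QuantumFields.Balaban3D.Carriers
open Summit.QuantumFields.Balaban3D.Proofs.ScalesArithmetic
open Summit.QuantumFields.Balaban3D.Proofs.Constants
open Summit.QuantumFields.Balaban3D.Proofs.Inputs
open Summit.QuantumFields.Balaban3D.Proofs.Primitives

variable {L N : ℕ}

/-! ## §1 The thresholds on the exhibited family -/

section Family

variable {𝔠 : AlphaConsts L N} {S : Scales L} (hS : S.ε₀ = eps0Of 𝔠.gamma0 S.g)
include hS

/-- On the exhibited family: `g_k ≤ γ₂₈` for `k ≤ K`. [cite: Balaban1985UV3, p.256 L15–18] -/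
theorem gk_le_gamma28 (k : ℕ) (hk : k ≤ S.K) : S.gk k ≤ 𝔠.gamma28 :=
  (gk_le_gamma0_of_eps0Of S 𝔠.gamma0_pos.le hS k hk).trans (gammaMin_le (by simp))

/-- On the exhibited family: `g_k ≤ γ₄₆` for `k ≤ K`. [cite: Balaban1985UV3, (45) p.267] -/
theorem gk_le_gamma46 (k : ℕ) (hk : k ≤ S.K) : S.gk k ≤ 𝔠.gamma46 :=
  (gk_le_gamma0_of_eps0Of S 𝔠.gamma0_pos.le hS k hk).trans (gammaMin_le (by simp))

/-- On the exhibited family: `g_k ≤ γ_OO` for `k ≤ K`. [cite: Balaban1985UV3, p.272] -/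
theorem gk_le_gammaOO (k : ℕ) (hk : k ≤ S.K) : S.gk k ≤ 𝔠.gammaOO :=
  (gk_le_gamma0_of_eps0Of S 𝔠.gamma0_pos.le hS k hk).trans (gammaMin_le (by simp))

/-- On the exhibited family: `g_k ≤ γ₇₁` for `k ≤ K`. [cite: Balaban1985UV3, (71) p.273] -/
theorem gk_le_gamma71 (k : ℕ) (hk : k ≤ S.K) : S.gk k ≤ 𝔠.gamma71 :=
  (gk_le_gamma0_of_eps0Of S 𝔠.gamma0_pos.le hS k hk).trans (gammaMin_le (by simp))

/-- **(28) SMALLNESS ON THE FAMILY**: `cB·(r(g_k)g_kp(g_k)) ≤ ρ/4` for `k ≤ K` («for g₀ sufficiently small the number on the right-hand side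
above is small», p. 263 L29; p6 `ChartThreshold.small28_of_le_gamma28`). [cite: Balaban1985UV3, (28) p.263] -/
theorem small28 (k : ℕ) (hk : k ≤ S.K) :
    𝔠.cB * (rFun 𝔠.r₀ (S.gk k) * S.gk k * pFun 𝔠.b₀ 𝔠.p₀ (S.gk k)) ≤ 𝔠.ρ / 4 :=
  ChartThreshold.small28_of_le_gamma28 𝔠.ρ_pos 𝔠.cB_nonneg 𝔠.b₀_pos.le (le_trans zero_le_one 𝔠.one_le_r₀) 𝔠.p₀_pos
    (gk_pos S k) (gk_le_gamma28 hS k hk)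

end Family

/-! ## §2 The provisos NOT IN PRINT of row B25, discharged by the definition of `b₀`, `p₀` (R-E2′) -/

section Provisos

variable (𝔠 : AlphaConsts L N)

/-- `b₀²/(4N) = max(56, 8·A·K_c³/(½ log L))` for `N ≥ 1` (the defining property of `b₀`). [folklore] -/
theorem b₀_sq_div (hN : 0 < N) :
    1 / (4 * (N : ℝ)) * 𝔠.b₀ ^ 2 = max 56 (8 * (𝔠.Alf * 𝔠.Kc ^ 3 / (Real.log (L : ℝ) / 2))) := by
  have hN1 : (1 : ℝ) ≤ N := by exact_mod_cast hN
  have hN0 : (0 : ℝ) < N := by exact_mod_cast hN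
  have hm : (0 : ℝ) ≤ max 56 (8 * (𝔠.Alf * 𝔠.Kc ^ 3 / (Real.log (L : ℝ) / 2))) := le_trans (by norm_num) (le_max_left _ _)
  unfold AlphaConsts.b₀
  rw [max_eq_left hN1, Real.sq_sqrt (by positivity)]
  field_simp

/-- **PROVISO E2-2 HOLDS** (NOT IN PRINT, LQB GAP G-B10-10 (d); print (7) p. 257 «b₀ is a sufficiently large absolute constant»):
`8·(A·K_c³/(½ log L)) ≤ b₀²/(4N)` for the lane's carrier constants, `N ≥ 1` — by the definition of `b₀`. [cite: Balaban1985UV3, (7) p.257 + pp.273–274] -/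
theorem prov_hb₁ (hN : 0 < N) :
    8 * ((((𝔠.lane.carrier.Cz + 𝔠.lane.carrier.Cv) + 𝔠.lane.carrier.C₅ + 𝔠.lane.carrier.C₆
        + (|𝔠.lane.carrier.logσ₀| + 𝔠.lane.carrier.dg) * 𝔠.lane.carrier.c₁) *
      (2 * (2 * ((𝔠.lane.carrier.R₁ + 1) * 𝔠.lane.carrier.M₁) + 2 * ((L : ℝ) * (3 * ((𝔠.lane.carrier.M₁ : ℝ) - 1))
        + 3 * ((L : ℝ) - 1)) + 20) * 1) ^ 3 / (Real.log 𝔠.lane.consts.L / 2))) ≤ 1 / (4 * (N : ℝ)) * 𝔠.lane.carrier.b₀ ^ 2 := by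
  show 8 * (𝔠.Alf * 𝔠.Kc ^ 3 / (Real.log (L : ℝ) / 2)) ≤ 1 / (4 * (N : ℝ)) * 𝔠.b₀ ^ 2
  rw [b₀_sq_div 𝔠 hN]
  exact le_max_right _ _

/-- **PROVISO E2-3 HOLDS** (NOT IN PRINT, LQB GAP G-B10-10): `56 ≤ b₀²/(4N)`, `N ≥ 1` — by the definition of `b₀`. [cite: Balaban1985UV3, (7) p.257] -/
theorem prov_hb₂ (hN : 0 < N) : 56 ≤ 1 / (4 * (N : ℝ)) * 𝔠.lane.carrier.b₀ ^ 2 := by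
  show (56 : ℝ) ≤ 1 / (4 * (N : ℝ)) * 𝔠.b₀ ^ 2
  rw [b₀_sq_div 𝔠 hN]
  exact le_max_left _ _

/-- **PROVISO E2-1 HOLDS** (NOT IN PRINT, LQB GAP G-B10-02; print (7) «p₀ > 2», `r₀` free): `3r₀ + 2 ≤ 2p₀` for the lane's carrier
constants — by the definition `p₀ := 2r₀ + 1`. [cite: Balaban1985UV3, (7) p.257] -/
theorem prov_hp : 𝔠.lane.carrier.r₀ * 3 + 2 ≤ 2 * 𝔠.lane.carrier.p₀ := 𝔠.prov_r₀p₀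

end Provisos

end Summit.QuantumFields.Balaban3D.Proofs.Family

end
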